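import Summits.PneNP.PneNP.Theses.KarlinRubin

/-!
# Sketch — crux ideas for `MonotoneBlind` (stmt-PneNP-18027), ideator 2, round 1

First-lemma signatures of two crux idea cards (planner-cruxidea-stmt-PneNP-18027-2-0, 2026-08-17):

* §A `vertex-cover-duality` — condition on the noise `x`, pass to the VERTEX up-set
  `𝒰_C(x) = {A ⊆ V : C(x ∪ K_A) = 1}`, certify blindness by `(k/n)`-cheap covers (Park–Pham duality).
* §B `maxima-anticoncentration` — exact treatment of threshold sub-computations by anti-concentration of
  maxima (Nazarov / Chernozhukov–Chetverikov–Kato) instead of approximation: depth-two monotone threshold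
  circuits (ORs of nonnegative-weight edge halfspaces) are blind below `√n`.

Everything is a `def … : Prop` (signatures); nothing is proved here.
-/

set_option linter.dupNamespace false

namespace Summit.PneNP.PneNP.Cruxes.MonotoneBlind.IdeaSketch

open Literature.Computability.Complexity Literature.Probability.RandomGraphs.PlantedClique Filter Finset
open Summit.PneNP.PneNP.Theses.KarlinRubin

/-! ## §A Vertex-lattice cover duality -/

/-- The clique-completion VERTEX up-set of a circuit `C` at noise `x`: the vertex sets `A` whose planting
makes `C` accept (`plant A x = x ∪ K_A`). It is increasing in `A` whenever `C` is monotone. -/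
def cliqueCompletion {n : ℕ} (C : Circuit ((⊤ : SimpleGraph (Fin n)).edgeSet)) (x : EdgeVec n) :
    Set (Finset (Fin n)) :=
  {A | C.eval (plant A x) = true}

/-- `G` covers `U`: every member of `U` contains some member of `G` (Park–Pham: `U ⊆ ⟨G⟩`). -/
def IsVertexCover {n : ℕ} (U : Set (Finset (Fin n))) (G : Finset (Finset (Fin n))) : Prop :=
  ∀ A ∈ U, ∃ S ∈ G, S ⊆ A

/-- The `(k/n)`-cost of a cover: `Σ_{S ∈ G} (k/n)^{|S|}` (an upper bound for `Pr_A[∃ S ∈ G, S ⊆ A]`,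
`A` a uniformly random `k`-set, since `Pr[S ⊆ A] = (k)_s/(n)_s ≤ (k/n)^s`). -/
noncomputable def coverCost (n k : ℕ) (G : Finset (Finset (Fin n))) : ℝ :=
  ∑ S ∈ G, ((k : ℝ) / n) ^ S.card

open Classical in
/-- `Pr_A[A ∈ U]` for a uniformly random `k`-subset `A` of `Fin n` (junk `0` if `n < k`). -/
noncomputable def kSetProb (n k : ℕ) (U : Set (Finset (Fin n))) : ℝ :=
  (#((powersetCard k (univ : Finset (Fin n))).filter (· ∈ U)) : ℝ) / (n.choose k : ℝ)

/-- **Cover bound (provable now, S/M).** A cover of cost `η` certifies `Pr_A[A ∈ U] ≤ η`. -/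
def CoverBound : Prop :=
  ∀ n k : ℕ, ∀ U : Set (Finset (Fin n)), ∀ G : Finset (Finset (Fin n)),
    IsVertexCover U G → kSetProb n k U ≤ coverCost n k G

/-- **Planting identity (provable now, M).** The planted acceptance probability is the noise-average of the
`k`-set measure of the clique-completion up-set: `Pr_P[C = 1] = E_x Pr_A[A ∈ 𝒰_C(x)]` (unfold
`plantedCliqueDist = (uniform k-sets).bind (x ↦ plant)`); stated as the inequality the line needs: if the
up-set has an `η`-cheap cover outside an `x`-set of null measure `≤ ε`, then `Pr_P[C = 1] ≤ η + ε`. -/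
def PlantingIdentity : Prop :=
  ∀ n k : ℕ, ∀ C : Circuit ((⊤ : SimpleGraph (Fin n)).edgeSet), ∀ η ε : ℝ, 0 ≤ η → 0 ≤ ε →
    ((erdosRenyiHalf n).toOuterMeasure
        {x | ¬ ∃ G : Finset (Finset (Fin n)), IsVertexCover (cliqueCompletion C x) G ∧ coverCost n k G ≤ η})
      ≤ ENNReal.ofReal ε →
    (plantedCliqueDist n k).toOuterMeasure {x | C.eval x = true} ≤ ENNReal.ofReal (η + ε)

/-- **CoverCertificateAt δ** — the dual certificate of blindness at clique exponent `1/2 - δ`: for every size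
exponent `c` and every monotone `≤ n^c` family whose NULL acceptance probability tends to `0`, for every
`η > 0`, the null probability of the noises `x` at which the clique-completion up-set has NO `η`-cheap
`(k/n)`-cover tends to `0` (`k = ⌈n^{1/2-δ}⌉`). By `CoverBound` + `PlantingIdentity` it implies
`Pr_P[C = 1] → 0`, hence the crux at `δ`; by Park–Pham (arXiv:2203.17207, Thm 1.1) it is implied by strong
blindness at any `δ' < δ` (the `K log n` loss in the clique size is absorbed by the exponent), so the
certificate loses nothing. -/
def CoverCertificateAt (δ : ℝ) : Prop :=
  ∀ c : ℕ, ∀ C : (n : ℕ) → Circuit ((⊤ : SimpleGraph (Fin n)).edgeSet),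
    (∀ᶠ n : ℕ in atTop, (C n).IsOver monotoneBasis01 ∧ (C n).size ≤ n ^ c) →
    Tendsto (fun n : ℕ => (erdosRenyiHalf n).toOuterMeasure {x | (C n).eval x = true}) atTop (nhds 0) →
    ∀ η : ℝ, 0 < η →
      Tendsto (fun n : ℕ => (erdosRenyiHalf n).toOuterMeasure
        {x | ¬ ∃ G : Finset (Finset (Fin n)), IsVertexCover (cliqueCompletion (C n) x) G ∧
          coverCost n ⌈(n : ℝ) ^ (1 / 2 - δ)⌉₊ G ≤ η}) atTop (nhds 0)

/-- **First lemma of card A (sufficiency of the dual certificate; provable now, M).** -/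
def FirstLemmaA : Prop :=
  (∀ δ : ℝ, 0 < δ → δ < 1 / 2 → CoverCertificateAt δ) → MonotoneBlind

/-- **Universal sub-logarithmic invisibility (provable now, M; the base of the vertex lattice).** Planting a
clique on a uniformly random vertex set of CONSTANT size `j` changes the acceptance probability of ANY
monotone circuit (no size bound) by `≤ 2^{j²} · n^{-1/2}` for large `n` (edge-isoperimetric / level-1
inequality `Σ_e Inf_e ≤ √N`, one edge at a time inside the random `j`-set). -/
def SmallPlantInvisible : Prop :=
  ∀ j : ℕ, ∀ᶠ n : ℕ in atTop, ∀ C : Circuit ((⊤ : SimpleGraph (Fin n)).edgeSet),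
    C.IsOver monotoneBasis01 →
      ((plantedCliqueDist n j).toOuterMeasure {x | C.eval x = true}).toReal ≤
        ((erdosRenyiHalf n).toOuterMeasure {x | C.eval x = true}).toReal +
          (2 : ℝ) ^ (j ^ 2) * (n : ℝ) ^ (-(1 : ℝ) / 2)

/-! ## §B Anti-concentration of maxima: depth-two monotone threshold circuits -/

/-- A monotone threshold gate over the edge indicators: nonnegative weights and a threshold. -/
structure Halfspace (n : ℕ) where
  w : (⊤ : SimpleGraph (Fin n)).edgeSet → ℝ
  w_nonneg : ∀ e, 0 ≤ w e
  t : ℝ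

/-- The gate's statistic `Σ_e w_e x_e`. -/
noncomputable def Halfspace.stat {n : ℕ} (h : Halfspace n) (x : EdgeVec n) : ℝ :=
  ∑ e, (if x e then h.w e else 0)

/-- The gate fires on `x` iff `Σ_e w_e x_e ≥ t`. -/
def Halfspace.Accepts {n : ℕ} (h : Halfspace n) (x : EdgeVec n) : Prop :=
  h.t ≤ h.stat x

/-- `ℓ²`-norm of the weight vector. -/
noncomputable def Halfspace.l2 {n : ℕ} (h : Halfspace n) : ℝ := Real.sqrt (∑ e, h.w e ^ 2)

/-- The `k`-compact mass of a gate is at most `m`: the weight carried by the edges inside any one `k`-set of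
vertices (the worst-case planted shift of the gate's statistic) is `≤ m`. -/
def Halfspace.KCompactMassLe {n : ℕ} (h : Halfspace n) (k : ℕ) (m : ℝ) : Prop :=
  ∀ B : Finset (Fin n), B.card ≤ k →
    (∑ e : (⊤ : SimpleGraph (Fin n)).edgeSet,
      (if (∀ v ∈ (e : Sym2 (Fin n)), v ∈ B) then h.w e else 0)) ≤ m

/-- **DepthTwoThresholdBlindAt δ** (the rung in kind; conjectured provable, L–XL): no family of ORs of at
most `n^c + 1` nonnegative-weight edge halfspaces strongly detects the planted `⌈n^{1/2-δ}⌉`-clique. The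
class contains every degree / common-neighbourhood / clique-indicator test of the census (N1) at depth two. -/
def DepthTwoThresholdBlindAt (δ : ℝ) : Prop :=
  ∀ c : ℕ, ∀ H : (n : ℕ) → Fin (n ^ c + 1) → Halfspace n,
    ¬ (Tendsto (fun n : ℕ => (erdosRenyiHalf n).toOuterMeasure {x | ∃ i, (H n i).Accepts x} +
        (plantedCliqueDist n ⌈(n : ℝ) ^ (1 / 2 - δ)⌉₊).toOuterMeasure {x | ¬ ∃ i, (H n i).Accepts x})
        atTop (nhds 0))

/-- **First lemma of card B — the spread case (provable from the high-dimensional CLT for maxima +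
Nazarov's inequality, L).** If every gate's `k`-compact mass is `≤ n^{-ε} · ‖w‖₂` eventually (worst-case
normalised planted shift `→ 0`), an OR of `≤ n^c + 1` such gates cannot strongly detect: the null vector of
gate statistics sits in the boundary strip of width `n^{-ε}` of the rejection rectangle with probability
`O(n^{-ε} √(c log n)) + o(1)`. -/
def SpreadHalfspaceBlindAt (δ ε : ℝ) : Prop :=
  ∀ c : ℕ, ∀ H : (n : ℕ) → Fin (n ^ c + 1) → Halfspace n,
    (∀ᶠ n : ℕ in atTop, ∀ i,
      (H n i).KCompactMassLe ⌈(n : ℝ) ^ (1 / 2 - δ)⌉₊ ((n : ℝ) ^ (-ε) * (H n i).l2)) →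
    ¬ (Tendsto (fun n : ℕ => (erdosRenyiHalf n).toOuterMeasure {x | ∃ i, (H n i).Accepts x} +
        (plantedCliqueDist n ⌈(n : ℝ) ^ (1 / 2 - δ)⌉₊).toOuterMeasure {x | ¬ ∃ i, (H n i).Accepts x})
        atTop (nhds 0))

/-- **Window lemma (the single-gate mechanism, provable now, M):** for one nonnegative halfspace whose
weights are bounded by `M`, the null probability of the window `[t - Δ, t)` below the threshold is at most
`C₀ · (Δ + M) / ‖w‖₂` (Erdős–Littlewood–Offord / Kolmogorov–Rogozin anti-concentration for sums of
independent fair bits with weights `w ≥ 0`). -/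
def WindowLemma : Prop :=
  ∃ C₀ : ℝ, 0 < C₀ ∧ ∀ n : ℕ, ∀ h : Halfspace n, ∀ Δ M : ℝ, 0 ≤ Δ → (∀ e, h.w e ≤ M) → 0 < h.l2 →
    ((erdosRenyiHalf n).toOuterMeasure {x | h.t - Δ ≤ h.stat x ∧ ¬ h.Accepts x}).toReal
      ≤ C₀ * (Δ + M) / h.l2

end Summit.PneNP.PneNP.Cruxes.MonotoneBlind.IdeaSketch
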